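import Summits.QuantumAdvantage.AdviceFreeQNC0.M19AffineTests
import HarnessLib

/-!
# M19 part 6: THEOREM B′ `stepFormLoss` (step forms, bounded alternation) and Theorem B recovered

PROVENANCE / PORT (ask P2-19a): authored by the planner seat qa-qnc0-p2 g19 (`HOME/qa-qnc0-p2/line19/M19Proofs.lean`, 1542 lines,
farm rc 0 / 0 sorry / 0 warnings), ported by qn-prover-3 g12 as six files `M19Linearisation` → `M19SegmentCounter` →
`M19FormExpansion` → `M19IntervalLoss` → `M19AffineTests` → `M19StepForms`; everything is placed in the namespace
`Summit.QuantumAdvantage.AdviceFreeQNC0.M19` (so `M19.winCount` / `M19.lossCount` do not shadow the cell's `AffBells22.winCount`),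
28 one-line docstrings were added, nothing else changed.  Separation NOT moved.
-/

/-! ## §B′ — STEP FORMS: the reach of the block design is BOUNDED ALTERNATION (gen 19, addendum C)

A cut may read `K` forms `Σ_i u_i a_j(i)` over `ZMod p` whose coefficient sequences `i ↦ a_j(i)` are STEP FUNCTIONS with at
most `B` steps each (positions `i` with `a_j(i) ≠ a_j(i+1)`), combined by an arbitrary Boolean function.  Interval counters are
the case `a_j = 1_{[a,b)}` (`B = 2`); weighted counters with few weight changes, complements of intervals, unions of runs are
all covered.  The letter sequence of every term then has at most `KB + 1` breakpoints, so among `KB + 2` blocks of `2p`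
consecutive posts one is free and carries the term's letter: `#LOSE ≥ 2^{n − 2p(KB+2)}`.  For `B = 2` this is exactly
Theorem B's constant. -/

section StepForms

namespace Summit.QuantumAdvantage.AdviceFreeQNC0.M19

open Finset

variable {F : Type} [Field F]

/-- the value of the form with coefficient sequence `a` at `u`: `Σ_{i : u_i = 1} a(i)`. -/
def formVal {p n : ℕ} (a : Fin n → ZMod p) (u : Fin n → Bool) : ZMod p :=
  ∑ i, if u i = true then a i else 0

/-- the steps of a coefficient sequence: consecutive pairs `(i, i+1)` with `a(i) ≠ a(i+1)`. -/
def stepSet {p n : ℕ} (a : Fin n → ZMod p) : Finset (Fin n × Fin n) :=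
  univ.filter fun q => q.2.val = q.1.val + 1 ∧ a q.1 ≠ a q.2

/-- number of steps of a coefficient sequence. -/
def stepCount {p n : ℕ} (a : Fin n → ZMod p) : ℕ := (stepSet a).card

/-- Theorem B′ class: cut `g` reads `K` step forms with `≤ B` steps each (mod `p`), through an arbitrary table. -/
def IsStepFormStrategy (p K B n : ℕ) (y : Fin (n + 1) → (Fin n → Bool) → Bool) : Prop :=
  ∀ g : Fin (n + 1), ∃ L : Fin K → Fin n → ZMod p, (∀ j, stepCount (L j) ≤ B) ∧
    ∀ u v : Fin n → Bool, (∀ j, formVal (L j) u = formVal (L j) v) → y g u = y g v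

/-- **Theorem B′** (flag-less): `p` odd, `3 ∤ p`, `n ≥ 2p(KB+2)` ⇒ every `(K,B)`-step-form strategy loses on
`≥ 2^{n − 2p(KB+2)}` inputs, every charge. -/
def StepFormLoss (p : ℕ) : Prop :=
  Odd p → ¬ 3 ∣ p → ∀ (K B n c : ℕ) (y : Fin (n + 1) → (Fin n → Bool) → Bool),
    IsStepFormStrategy p K B n y → 2 * p * (K * B + 2) ≤ n → 2 ^ (n - 2 * p * (K * B + 2)) ≤ lossCount c y

variable {p : ℕ} [NeZero p] (ψ : AddChar (ZMod p) F) (η : F)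

/-- **The block design hits every term of a step-form strategy**: `KB+2` blocks of `2p` consecutive posts, at most `KB+1`
breakpoints (the steps and the cut), a free block on which the letter is constant, and the block carries it. -/
theorem step_hit (hη3 : η ^ 3 = 1) {n K B : ℕ} (hn : 2 * p * (K * B + 2) ≤ n)
    (L : Fin (n + 1) → Fin K → Fin n → ZMod p) (hL : ∀ g j, stepCount (L g j) ≤ B)
    (g : Fin (n + 1)) (cv : Fin K → ZMod p) (bb : Fin 2) :
    ∃ i ∈ (univ : Finset (Fin (2 * p * (K * B + 2)))).map (Fin.castLEEmb hn),
      formρ ψ η L g cv bb i = blockLetter p ψ η (i.val % (2 * p)) := by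
  classical
  have hp : 0 < p := NeZero.pos p
  -- breakpoints: right ends of the steps of the K forms, and the cut
  set Bk : Finset ℕ := ((univ : Finset (Fin K)).biUnion fun j => (stepSet (L g j)).image fun q => q.2.val) ∪ {g.val}
    with hBk
  have hBkcard : Bk.card ≤ K * B + 1 := by
    rw [hBk]
    refine (Finset.card_union_le _ _).trans ?_
    rw [Finset.card_singleton]
    refine Nat.add_le_add_right ?_ 1
    refine Finset.card_biUnion_le.trans ?_
    calc ∑ j, ((stepSet (L g j)).image fun q => q.2.val).card ≤ ∑ _j : Fin K, B :=
          Finset.sum_le_sum fun j _ => Finset.card_image_le.trans (hL g j)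
      _ = K * B := by rw [Finset.sum_const, Finset.card_univ, Fintype.card_fin, smul_eq_mul]
  have hcard : (Bk.image fun t => (t - 1) / (2 * p)).card < (Finset.range (K * B + 2)).card := by
    rw [Finset.card_range]
    exact lt_of_le_of_lt (Finset.card_image_le.trans hBkcard) (by omega)
  obtain ⟨m, hm, hnot⟩ := Finset.exists_mem_notMem_of_card_lt_card hcard
  rw [Finset.mem_range] at hm
  have hfree : ∀ t ∈ Bk, ¬ (2 * p * m < t ∧ t < 2 * p * m + 2 * p) := by
    intro t ht hlt
    apply hnot
    rw [Finset.mem_image]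
    refine ⟨t, ht, ?_⟩
    obtain ⟨hlt1, hlt2⟩ := hlt
    refine Nat.div_eq_of_lt_le ?_ ?_
    · rw [Nat.mul_comm m (2 * p)]; omega
    · rw [Nat.add_mul, Nat.mul_comm m (2 * p)]; omega
  have hg : ¬ (2 * p * m < g.val ∧ g.val < 2 * p * m + 2 * p) := hfree _ (by rw [hBk]; simp)
  have hblk : 2 * p * m + 2 * p ≤ 2 * p * (K * B + 2) := by
    have := Nat.mul_le_mul_left (2 * p) (show m + 1 ≤ K * B + 2 by omega)
    rw [Nat.mul_succ] at this
    exact this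
  -- no step strictly inside the free block: the forms are constant on it
  have hstep : ∀ j (q : ℕ) (hq : q < 2 * p),
      L g j ⟨2 * p * m + q, by omega⟩ = L g j ⟨2 * p * m, by omega⟩ := by
    intro j q hq
    induction q with
    | zero => rfl
    | succ q ih =>
      rw [← ih (by omega)]
      by_contra hne
      have hmem : 2 * p * m + (q + 1) ∈ Bk := by
        rw [hBk, Finset.mem_union]
        left
        rw [Finset.mem_biUnion]
        refine ⟨j, Finset.mem_univ _, Finset.mem_image.mpr ?_⟩
        refine ⟨(⟨2 * p * m + q, by omega⟩, ⟨2 * p * m + (q + 1), by omega⟩), ?_, rfl⟩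
        unfold stepSet
        rw [Finset.mem_filter]
        exact ⟨Finset.mem_univ _, by simp only [Nat.add_assoc], fun h => hne h.symm⟩
      exact hfree _ hmem ⟨by omega, by omega⟩
  -- the letter on the free block, and the post of the block carrying it
  set z : ZMod p := ∑ j, cv j * L g j ⟨2 * p * m, by omega⟩ with hz
  obtain ⟨e, he, hlab⟩ := label_letter η hη3 bb (2 * p * m < g.val)
  obtain ⟨q, hq, hql⟩ := block_carries ψ η z e he
  refine ⟨Fin.castLE hn ⟨2 * p * m + q, by omega⟩,
    Finset.mem_map.mpr ⟨⟨2 * p * m + q, by omega⟩, Finset.mem_univ _, rfl⟩, ?_⟩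
  have hmod : (2 * p * m + q) % (2 * p) = q := by
    rw [Nat.mul_add_mod]
    exact Nat.mod_eq_of_lt hq
  show ψ (∑ j, cv j * L g j ⟨2 * p * m + q, by omega⟩)
      * ((if 2 * p * m + q < g.val then η ^ (bb.val + 1) else 1) * η ^ (bb.val + 1))
      = blockLetter p ψ η ((2 * p * m + q) % (2 * p))
  have h1 : (∑ j, cv j * L g j ⟨2 * p * m + q, by omega⟩) = z := by
    rw [hz]
    refine Finset.sum_congr rfl (fun j _ => ?_)
    rw [hstep j q hq]
  have h2 : (2 * p * m + q < g.val) ↔ (2 * p * m < g.val) := by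
    constructor
    · intro h; omega
    · intro h; omega
  rw [hmod, hql, h1, if_congr h2 rfl rfl, hlab]

/-- **Theorem B′, kernel form.** -/
theorem stepFormLoss (p : ℕ) : StepFormLoss p := by
  intro hp h3 K B n c y hy hn
  classical
  haveI : NeZero p := ⟨by obtain ⟨k, hk⟩ := hp; omega⟩
  obtain ⟨F, instF, instC, η, ξ, hη, hξ⟩ := exists_charTwo_field_with_roots p hp
  have hη3 : η ^ 3 = 1 := hη.pow_eq_one
  have hη1 : η ≠ 1 := hη.ne_one (by norm_num)
  let ψ : AddChar (ZMod p) F := AddChar.zmodChar p hξ.pow_eq_one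
  have hψ : ∀ z : ZMod p, ψ z = ξ ^ z.val := fun z => AddChar.zmodChar_apply _ z
  have hψp : ∀ z : ZMod p, (ψ z) ^ p = 1 := by
    intro z
    rw [hψ, ← pow_mul, mul_comm, pow_mul, hξ.pow_eq_one, one_pow]
  choose L hLB hab using hy
  let β : Fin (n + 1) → Fin K → ZMod p := fun _ _ => 0
  let f : Fin (n + 1) → (Fin K → ZMod p) → Bool := fun g r =>
    decide (∃ v : Fin n → Bool, (fun j => formVal (L g j) v) = r ∧ y g v = true)
  have hform : ∀ g u, (fun j => β g j + ∑ i, (if u i = true then L g j i else 0))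
      = fun j => formVal (L g j) u := by
    intro g u
    funext j
    rw [zero_add]
    rfl
  have hf : ∀ g u, y g u = f g (fun j => β g j + ∑ i, (if u i = true then L g j i else 0)) := by
    intro g u
    rw [hform g u]
    cases hyu : y g u
    · symm
      apply decide_eq_false
      rintro ⟨v, h1, h2⟩
      have hsame := hab g u v (fun j => (congrFun h1 j).symm)
      rw [hyu, h2] at hsame
      exact Bool.false_ne_true hsame
    · symm
      apply decide_eq_true
      exact ⟨u, rfl, hyu⟩
  have hP : ((Finset.univ : Finset (Fin (2 * p * (K * B + 2)))).map (Fin.castLEEmb hn)).card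
      = 2 * p * (K * B + 2) := by simp
  have key := loss_ge_of_posts c y (Fin (n + 1) × (Fin K → ZMod p) × (Fin K → ZMod p) × Fin 2) Finset.univ
    (fun t => formC ψ η c f β t.1 t.2.1 t.2.2.1 t.2.2.2) (fun t => formρ ψ η L t.1 t.2.2.1 t.2.2.2)
    ((Finset.univ : Finset (Fin (2 * p * (K * B + 2)))).map (Fin.castLEEmb hn))
    (fun i => blockLetter p ψ η (i.val % (2 * p)))
    (fun i _ => blockLetter_ne_one ψ η hη h3 hψp _)
    (fun t _ => step_hit ψ η hη3 hn L hLB t.1 t.2.2.1 t.2.2.2)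
    (form_expansion ψ η hη3 hη1 hp hξ hψ c y L β f hf)
  rw [hP] at key
  exact key

/-- **Theorem B′, θ-form**: `(K,B)`-step-form strategies win at most `(1 − 2^{−2p(KB+2)})·2ⁿ` from `n = 2p(KB+2)` on. -/
theorem stepForm_theta (p K B : ℕ) (hp : Odd p) (h3 : ¬ 3 ∣ p) :
    ∃ θ : ℝ, θ < 1 ∧ ∃ n₀ : ℕ, ∀ n ≥ n₀, ∀ c : ℕ, ∀ y : Fin (n + 1) → (Fin n → Bool) → Bool,
      IsStepFormStrategy p K B n y →
        ((Finset.univ.filter fun u : Fin n → Bool => ringWinU c y u = true).card : ℝ) ≤ θ * (2 : ℝ) ^ n := by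
  refine ⟨1 - 1 / 2 ^ (2 * p * (K * B + 2)), by
    have : (0 : ℝ) < 1 / 2 ^ (2 * p * (K * B + 2)) := by positivity
    linarith, 2 * p * (K * B + 2), ?_⟩
  intro n hn c y hy
  exact win_le_of_loss_ge (winCount_add_lossCount c y) hn (stepFormLoss p hp h3 K B n c y hy hn)

/-- Interval strategies are `(K,2)`-step-form strategies (an interval indicator steps at most at `a` and at `b`). -/
theorem isStepForm_of_isInterval {p K n : ℕ} {y : Fin (n + 1) → (Fin n → Bool) → Bool}
    (hy : IsIntervalStrategy p K n y) : IsStepFormStrategy p K 2 n y := by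
  classical
  intro g
  obtain ⟨a, b, hab⟩ := hy g
  refine ⟨fun j i => if a j ≤ i.val ∧ i.val < b j then 1 else 0, fun j => ?_, fun u v huv => hab u v (fun j => ?_)⟩
  · -- at most two steps: the right ends of the steps lie in {a j, b j} and determine the pair
    unfold stepCount
    have hinj : Set.InjOn (fun q : Fin n × Fin n => q.2.val) (stepSet (fun i : Fin n =>
        if a j ≤ i.val ∧ i.val < b j then (1 : ZMod p) else 0) : Set (Fin n × Fin n)) := by
      intro q hq q' hq' h
      simp only [Finset.mem_coe, stepSet, Finset.mem_filter] at hq hq'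
      have h2 : q.2 = q'.2 := Fin.ext h
      have h1 : q.1 = q'.1 := Fin.ext (by omega)
      exact Prod.ext h1 h2
    have hmaps : ∀ q ∈ stepSet (fun i : Fin n => if a j ≤ i.val ∧ i.val < b j then (1 : ZMod p) else 0),
        (fun q : Fin n × Fin n => q.2.val) q ∈ ({a j, b j} : Finset ℕ) := by
      intro q hq
      simp only [stepSet, Finset.mem_filter, Finset.mem_univ, true_and] at hq
      obtain ⟨hsucc, hne⟩ := hq
      rw [Finset.mem_insert, Finset.mem_singleton]
      by_contra hno
      push Not at hno
      apply hne
      have : (a j ≤ q.1.val ∧ q.1.val < b j) ↔ (a j ≤ q.2.val ∧ q.2.val < b j) := by omega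
      rw [if_congr this rfl rfl]
    calc (stepSet fun i : Fin n => if a j ≤ i.val ∧ i.val < b j then (1 : ZMod p) else 0).card
        ≤ ({a j, b j} : Finset ℕ).card := Finset.card_le_card_of_injOn _ hmaps hinj
      _ ≤ 2 := Finset.card_le_two
  · -- same interval counters mod p
    have h := huv j
    unfold formVal at h
    rw [← wtInterval_cast (ZMod p) u (a j) (b j), ← wtInterval_cast (ZMod p) v (a j) (b j)] at h
    exact (ZMod.natCast_eq_natCast_iff' _ _ _).mp h

/-- Theorem B recovered from Theorem B′ (same constant `2p(2K+2)`). -/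
theorem intervalLoss_of_stepFormLoss (p : ℕ) (h : StepFormLoss p) : IntervalLoss p := by
  intro hp h3 K n c y hy hn
  have hn' : 2 * p * (K * 2 + 2) ≤ n := by rw [Nat.mul_comm K 2]; exact hn
  have := h hp h3 K 2 n c y (isStepForm_of_isInterval hy) hn'
  rw [Nat.mul_comm K 2] at this
  exact this

end Summit.QuantumAdvantage.AdviceFreeQNC0.M19

end StepForms
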